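import Mathlib.Algebra.MvPolynomial.Funext
import Mathlib.Logic.Equiv.Fintype
import Literature.Computability.AlgebraicComplexity.OrbitClosureIrreducible
import HarnessLib

/-!
# Landsberg–Manivel–Ressayre 2013, Proposition 4.1.1 — the subspace variety `Sub_r(S^d W^*)` is
# IRREDUCIBLE (proofs companion of `LMR13DualVarieties.lean`)

Cell `val-lit`, typer `val-lit-t11`, row `LMR13-A`. Honest framing: typed literature; VP ≠ VNP is
NOT proved and nothing here is progress on it.

Printed statement (Comment. Math. Helv. 88 (2013), Prop. 4.1.1, p. 482 = arXiv:1004.4802 Prop. 4.0.3,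
`p0010.txt:L18`): "`Sub_{k+2}(S^d ℂ^N)` is a reduced, irreducible component of `𝒟ual_{k,d,N}`." The
typed fact `LMR2013_prop_4_1_1` (`LMR13DualVarieties.lean`) renders "irreducible component" as
`IsCoeffIrreducibleComponent (subspaceVariety σ ℂ (k+2) d) (lmrDualScheme k d)` = inclusion
(PROVED, `subspaceVariety_subset_lmrDualScheme`, `LMR13SubspaceVarietyProofs.lean`) ∧ irreducibility
of `Sub` ∧ maximality. THIS FILE PROVES THE IRREDUCIBILITY (LMR §4, p. 481, arXiv `p0010.txt:L3–9`:
`Sub_{k+2}(S^dW^*) = {P ∈ S^dW^* | … P ∈ S^dU^* for some U^*}` "the subspace variety" — the image of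
the irreducible variety `GL(W) × S^d U^*` under the action map):

* `subspaceVariety_isCoeffZariskiIrreducible` — `IsCoeffZariskiIrreducible (subspaceVariety σ ℂ r d)`
  for all `r, d` (Hartshorne's definition, `LMR13DualVarieties.lean`).

Proof (ours; the print takes irreducibility of subspace varieties for granted, citing Weyman [8]
§7.2): `Sub_r = GL(W) · L_{S₀}` for ONE coordinate set `S₀` of size `min(r, |σ|)` (the tree's
definition quantifies over all coordinate sets `S` of size `≤ r`; a permutation of the variables
carries any such `S` into `S₀` — `exists_perm_mapsTo_of_card_le`, Mathlib
`Equiv.Perm.exists_extending_pair`), `L_{S₀}` = forms of degree `d` in the variables `S₀`, spanned by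
the monomials supported in `S₀`. The action map `(A, c) ↦ A · Σ_μ c_μ x^μ` is polynomial in `(A, c)`
(the generic substitution over the coefficient ring `ℂ[A, c]`, as in `OrbitClosureProofs.lean`), so a
test polynomial `p` on coefficient space pulls back to `P ∈ ℂ[A, c]`, a DOMAIN. If
`Sub ⊆ C₁ ∪ C₂` with `C_i` closed and `p_i` vanishes on `C_i`, then `P₁ · P₂ · det(A)` vanishes at
every point `(A, c)` (for `det A ≠ 0` the image point lies in `Sub`), hence is `0`
(`MvPolynomial.funext`), hence `P₁ = 0` or `P₂ = 0`, i.e. `p₁` or `p₂` vanishes on all of `Sub`.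
What stays FACT in `LMR2013_prop_4_1_1`: the maximality of `Sub_{k+2}` among the irreducible subsets
of `𝒟ual_{k,d,N}` and the reduced-tangent clause (ii). No new definitions of notions, no facts.

## References

* [LandsbergManivelRessayre2013] Comment. Math. Helv. 88 (2013) 469–484, §4 and Prop. 4.1.1 (p. 481–482);
  arXiv:1004.4802 §4, Prop. 4.0.3.
* [Weyman2003] J. Weyman, *Cohomology of vector bundles and syzygies*, CUP 2003, §7.2 (subspace
  varieties), cited by LMR as [8].
* [Hartshorne1977] R. Hartshorne, *Algebraic Geometry*, I §1 (irreducible sets).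
-/

noncomputable section

open MvPolynomial

namespace Literature.Computability.AlgebraicComplexity

variable {σ : Type*} [Fintype σ] [DecidableEq σ]

/-! ### Permutation transport of coordinate sets -/

omit [DecidableEq σ] in
/-- A coordinate set of size at most that of another is carried into it by a permutation of the
variables. [folklore] -/
private theorem exists_perm_mapsTo_of_card_le {S S' : Finset σ} (h : S.card ≤ S'.card) :
    ∃ π : Equiv.Perm σ, ∀ x ∈ S, π x ∈ S' := by
  classical
  have hle : Fintype.card ↥S ≤ Fintype.card ↥S' := by simpa using h
  obtain ⟨e₀⟩ := Function.Embedding.nonempty_of_card_le hle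
  obtain ⟨π, hπ⟩ := Equiv.Perm.exists_extending_pair (fun x : ↥S => (x : σ))
    (fun x : ↥S => ((e₀ x : ↥S') : σ)) Subtype.val_injective
    (Subtype.val_injective.comp e₀.injective)
  exact ⟨π, fun x hx => by rw [hπ ⟨x, hx⟩]; exact (e₀ ⟨x, hx⟩).2⟩

/-- The permutation matrix of `π⁻¹` as an element of `GL`; it acts on forms by `rename π`
(`linSubst_permMatrix`). [folklore] -/
private theorem exists_gl_linSubstRep_eq_rename (π : Equiv.Perm σ) :
    ∃ g : GL σ ℂ, ∀ f : MvPolynomial σ ℂ, linSubstRep σ ℂ g f = rename π f := by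
  refine ⟨Matrix.GeneralLinearGroup.mk'' ((π⁻¹).permMatrix ℂ) ?_, fun f => ?_⟩
  · rw [Matrix.det_permutation]
    exact (Units.isUnit _).map (Int.castRingHom ℂ)
  · rw [linSubstRep_apply]
    change linSubst σ ℂ ((π⁻¹).permMatrix ℂ) f = rename π f
    rw [linSubst_permMatrix, Equiv.Perm.inv_def, Equiv.symm_symm]

/-- **`Sub` is monotone in the coordinate set up to permutations**: if some `GL`-translate of `f`
involves only variables from `S` and `|S| ≤ |S'|`, then some `GL`-translate of `f` involves only
variables from `S'`. [folklore] -/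
private theorem exists_gl_vars_subset_of_card_le {f : MvPolynomial σ ℂ} {S S' : Finset σ}
    (h : S.card ≤ S'.card) (hf : ∃ g : GL σ ℂ, ↑((linSubstRep σ ℂ g f).vars) ⊆ (S : Set σ)) :
    ∃ g : GL σ ℂ, ↑((linSubstRep σ ℂ g f).vars) ⊆ (S' : Set σ) := by
  classical
  obtain ⟨g, hg⟩ := hf
  obtain ⟨π, hπ⟩ := exists_perm_mapsTo_of_card_le h
  obtain ⟨gπ, hgπ⟩ := exists_gl_linSubstRep_eq_rename (σ := σ) π
  refine ⟨gπ * g, ?_⟩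
  rw [map_mul, Module.End.mul_apply, hgπ]
  intro x hx
  have hx' := vars_rename π _ (Finset.mem_coe.mp hx)
  rw [Finset.mem_image] at hx'
  obtain ⟨y, hy, rfl⟩ := hx'
  exact Finset.mem_coe.mpr (hπ y (Finset.mem_coe.mp (hg (Finset.mem_coe.mpr hy))))

/-! ### The parametrisation `(A, c) ↦ A · Σ_μ c_μ x^μ` and its pullback -/

section Param

variable (σ)

/-- The monomials of degree `d` supported in the coordinate set `S₀` (a basis of `S^d U^*`,
`U^* = ⟨x_s : s ∈ S₀⟩`). [folklore] -/
private def subMonomials (S₀ : Finset σ) (d : ℕ) : Finset (σ →₀ ℕ) :=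
  (degMonomials σ d).filter fun μ => μ.support ⊆ S₀

variable {σ}

/-- The generic substitution matrix over the parameter ring `ℂ[A, c]`. [folklore] -/
private def paramMatrix (S₀ : Finset σ) (d : ℕ) :
    Matrix σ σ (MvPolynomial ((σ × σ) ⊕ ↥(subMonomials σ S₀ d)) ℂ) :=
  fun i j => X (Sum.inl (i, j))

/-- The generic form `Σ_μ c_μ x^μ` of `S^d U^*` over the parameter ring `ℂ[A, c]`. [folklore] -/
private def paramForm (S₀ : Finset σ) (d : ℕ) :
    MvPolynomial σ (MvPolynomial ((σ × σ) ⊕ ↥(subMonomials σ S₀ d)) ℂ) :=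
  ∑ μ : ↥(subMonomials σ S₀ d), C (X (Sum.inr μ)) * monomial (μ : σ →₀ ℕ) 1

/-- The generic translate `A · Σ_μ c_μ x^μ` over `ℂ[A, c]`. [folklore] -/
private def paramTranslate (S₀ : Finset σ) (d : ℕ) :
    MvPolynomial σ (MvPolynomial ((σ × σ) ⊕ ↥(subMonomials σ S₀ d)) ℂ) :=
  linSubst σ _ (paramMatrix S₀ d) (paramForm S₀ d)

/-- The form `Σ_μ c_μ x^μ` at a parameter value `c`. [folklore] -/
private def evalForm (S₀ : Finset σ) (d : ℕ) (c : ↥(subMonomials σ S₀ d) → ℂ) : MvPolynomial σ ℂ :=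
  ∑ μ : ↥(subMonomials σ S₀ d), C (c μ) * monomial (μ : σ →₀ ℕ) 1

/-- Specialising the parameters `(A, c)` in the generic translate gives `A · Σ_μ c_μ x^μ`
(the action map is polynomial in `(A, c)`; compare `map_eval_genericLinSubst`). [folklore] -/
private theorem map_eval_paramTranslate (S₀ : Finset σ) (d : ℕ) (A : Matrix σ σ ℂ)
    (c : ↥(subMonomials σ S₀ d) → ℂ) :
    map (eval (Sum.elim (fun ij : σ × σ => A ij.1 ij.2) c)) (paramTranslate S₀ d) =
      linSubst σ ℂ A (evalForm S₀ d c) := by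
  unfold paramTranslate linSubst
  rw [aeval_eq_bind₁, map_bind₁]
  have hF : (fun i : σ => map (eval (Sum.elim (fun ij : σ × σ => A ij.1 ij.2) c))
      (∑ j, paramMatrix S₀ d j i • X j)) = fun i => ∑ j, A j i • X j := by
    funext i
    simp only [map_sum, smul_eq_C_mul, map_mul, map_C, map_X, paramMatrix, eval_X, Sum.elim_inl]
  have hq : map (eval (Sum.elim (fun ij : σ × σ => A ij.1 ij.2) c)) (paramForm S₀ d) =
      evalForm S₀ d c := by
    simp only [paramForm, evalForm, map_sum, map_mul, map_C, eval_X, Sum.elim_inr, map_monomial,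
      map_one]
  rw [hF, hq, aeval_eq_bind₁]

/-- Coefficients of the generic translate specialise to those of `A · Σ_μ c_μ x^μ`. [folklore] -/
private theorem eval_coeff_paramTranslate (S₀ : Finset σ) (d : ℕ) (ν : σ →₀ ℕ) (A : Matrix σ σ ℂ)
    (c : ↥(subMonomials σ S₀ d) → ℂ) :
    eval (Sum.elim (fun ij : σ × σ => A ij.1 ij.2) c) (coeff ν (paramTranslate S₀ d)) =
      coeff ν (linSubst σ ℂ A (evalForm S₀ d c)) := by
  rw [← map_eval_paramTranslate S₀ d A c, coeff_map]

/-- The pullback of a test polynomial `p` on coefficient space along the parametrisation: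
`P(A, c) = p(coeffVec(A · Σ_μ c_μ x^μ))` (as `aeval`). [folklore] -/
private theorem aeval_pullback (S₀ : Finset σ) (d : ℕ) (p : MvPolynomial (σ →₀ ℕ) ℂ)
    (A : Matrix σ σ ℂ) (c : ↥(subMonomials σ S₀ d) → ℂ) :
    aeval (Sum.elim (fun ij : σ × σ => A ij.1 ij.2) c)
      (aeval (fun ν : σ →₀ ℕ => coeff ν (paramTranslate S₀ d)) p) =
      aeval (coeffVec (linSubst σ ℂ A (evalForm S₀ d c))) p := by
  have hFG : (fun ν : σ →₀ ℕ => aeval (Sum.elim (fun ij : σ × σ => A ij.1 ij.2) c)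
      (coeff ν (paramTranslate S₀ d))) = coeffVec (linSubst σ ℂ A (evalForm S₀ d c)) := by
    funext ν
    exact eval_coeff_paramTranslate S₀ d ν A c
  rw [← AlgHom.comp_apply, comp_aeval, hFG]

/-- The same with `eval`. [folklore] -/
private theorem eval_pullback (S₀ : Finset σ) (d : ℕ) (p : MvPolynomial (σ →₀ ℕ) ℂ)
    (A : Matrix σ σ ℂ) (c : ↥(subMonomials σ S₀ d) → ℂ) :
    eval (Sum.elim (fun ij : σ × σ => A ij.1 ij.2) c)
      (aeval (fun ν : σ →₀ ℕ => coeff ν (paramTranslate S₀ d)) p) =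
      aeval (coeffVec (linSubst σ ℂ A (evalForm S₀ d c))) p :=
  aeval_pullback S₀ d p A c

/-- The generic matrix has nonzero determinant (specialise at `A = 1`). [folklore] -/
private theorem det_paramMatrix_ne_zero (S₀ : Finset σ) (d : ℕ) : (paramMatrix S₀ d).det ≠ 0 := by
  intro h0
  have h1 := congrArg (eval (Sum.elim (fun ij : σ × σ => (1 : Matrix σ σ ℂ) ij.1 ij.2)
    (fun _ : ↥(subMonomials σ S₀ d) => (0 : ℂ)))) h0
  rw [RingHom.map_det, RingHom.mapMatrix_apply, map_zero] at h1
  have hM : (paramMatrix S₀ d).map (eval (Sum.elim (fun ij : σ × σ => (1 : Matrix σ σ ℂ) ij.1 ij.2)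
      (fun _ : ↥(subMonomials σ S₀ d) => (0 : ℂ)))) = 1 := by
    ext i j
    simp [paramMatrix]
  rw [hM, Matrix.det_one] at h1
  exact one_ne_zero h1

/-- Evaluating the determinant of the generic matrix. [folklore] -/
private theorem eval_det_paramMatrix (S₀ : Finset σ) (d : ℕ) (A : Matrix σ σ ℂ)
    (c : ↥(subMonomials σ S₀ d) → ℂ) :
    eval (Sum.elim (fun ij : σ × σ => A ij.1 ij.2) c) (paramMatrix S₀ d).det = A.det := by
  rw [RingHom.map_det, RingHom.mapMatrix_apply]
  congr 1
  ext i j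
  simp [paramMatrix]

end Param

/-! ### `Sub_r = GL · S^d U^*` for one coordinate subspace `U^*` -/

/-- The coefficients of the form `Σ_μ c_μ x^μ` vanish outside the chosen monomials. [folklore] -/
private theorem coeff_evalForm_of_notMem {S₀ : Finset σ} {d : ℕ} (c : ↥(subMonomials σ S₀ d) → ℂ)
    {ν : σ →₀ ℕ} (hν : ν ∉ subMonomials σ S₀ d) : coeff ν (evalForm S₀ d c) = 0 := by
  classical
  rw [evalForm, coeff_sum]
  refine Finset.sum_eq_zero fun μ _ => ?_
  rw [coeff_C_mul, coeff_monomial, if_neg, mul_zero]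
  rintro rfl
  exact hν μ.2

/-- The form `Σ_μ c_μ x^μ` is homogeneous of degree `d`. [folklore] -/
private theorem evalForm_isHomogeneous {S₀ : Finset σ} {d : ℕ} (c : ↥(subMonomials σ S₀ d) → ℂ) :
    (evalForm S₀ d c).IsHomogeneous d := by
  classical
  refine IsHomogeneous.sum _ _ _ fun μ _ => ?_
  rw [C_mul_monomial, mul_one]
  refine isHomogeneous_monomial _ ?_
  exact mem_degMonomials_iff.mp (Finset.mem_filter.mp μ.2).1

/-- The form `Σ_μ c_μ x^μ` involves only variables from `S₀`. [folklore] -/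
private theorem vars_evalForm_subset {S₀ : Finset σ} {d : ℕ} (c : ↥(subMonomials σ S₀ d) → ℂ) :
    ↑((evalForm S₀ d c).vars) ⊆ (S₀ : Set σ) := by
  classical
  intro x hx
  obtain ⟨ν, hν, hxν⟩ := (mem_vars_iff_mem_support x).mp (Finset.mem_coe.mp hx)
  have hνM : ν ∈ subMonomials σ S₀ d := by
    by_contra hνM
    exact (mem_support_iff.mp hν) (coeff_evalForm_of_notMem c hνM)
  exact Finset.mem_coe.mpr ((Finset.mem_filter.mp hνM).2 hxν)

/-- A form of degree `d` all of whose variables lie in `S₀` is the value of the generic form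
`Σ_μ c_μ x^μ` at `c = ` its coefficients. [folklore] -/
private theorem eq_evalForm_of_vars_subset {S₀ : Finset σ} {d : ℕ} {h : MvPolynomial σ ℂ}
    (hh : h.IsHomogeneous d) (hvars : ↑(h.vars) ⊆ (S₀ : Set σ)) :
    h = evalForm S₀ d (fun μ => coeff (μ : σ →₀ ℕ) h) := by
  classical
  have hsupp : h.support ⊆ subMonomials σ S₀ d := by
    intro ν hν
    refine Finset.mem_filter.mpr ⟨mem_degMonomials_iff.mpr ?_, fun i hi => ?_⟩
    · have := hh (mem_support_iff.mp hν)
      rw [Finsupp.degree_eq_weight_one]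
      exact this
    · exact Finset.mem_coe.mp (hvars (Finset.mem_coe.mpr (support_subset_vars_of_mem_support hν hi)))
  rw [evalForm]
  simp_rw [C_mul_monomial, mul_one]
  rw [Finset.sum_coe_sort (subMonomials σ S₀ d) (fun μ => monomial μ (coeff μ h))]
  conv_lhs => rw [h.as_sum]
  refine Finset.sum_subset hsupp fun μ _ hμ => ?_
  rw [mem_support_iff, not_not] at hμ
  rw [hμ, monomial_zero]

/-! ### Irreducibility -/

/-- **LMR 2013, Prop. 4.1.1 — `Sub_r(S^d W^*)` is IRREDUCIBLE** (the word "irreducible" of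
"`Sub_{k+2}(S^dℂ^N)` is a reduced, irreducible component of `𝒟ual_{k,d,N}`", journal p. 482, arXiv
Prop. 4.0.3 `p0010.txt:L18`; the subspace variety of §4, `p0010.txt:L3–9`): the tree's
`subspaceVariety σ ℂ r d` is irreducible in the coefficient-space Zariski topology
(`IsCoeffZariskiIrreducible`, Hartshorne I §1), for all `r, d`. PROVED (proof ours, recorded in the
module docstring: pull back separating polynomials along the polynomial parametrisation
`(A, c) ↦ A · Σ_μ c_μ x^μ` to the domain `ℂ[A, c]`). With `subspaceVariety_subset_lmrDualScheme`
(`LMR13SubspaceVarietyProofs.lean`) this leaves, of conjunct (i) of the typed `LMR2013_prop_4_1_1`,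
only the MAXIMALITY of `Sub_{k+2}` among the irreducible subsets of `𝒟ual_{k,d,N}`.
[cite: LandsbergManivelRessayre2013, Proposition 4.1.1 (p. 482)] -/
theorem subspaceVariety_isCoeffZariskiIrreducible (r d : ℕ) :
    IsCoeffZariskiIrreducible (subspaceVariety σ ℂ r d) := by
  classical
  -- the coordinate set `S₀`
  obtain ⟨S₀, -, hS₀card⟩ : ∃ S₀ : Finset σ, S₀ ⊆ Finset.univ ∧ S₀.card = min r (Fintype.card σ) :=
    Finset.exists_subset_card_eq (by rw [Finset.card_univ]; exact min_le_right _ _)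
  have hS₀r : S₀.card ≤ r := hS₀card ▸ min_le_left _ _
  -- every point of `Sub` is a parametrised point
  have hparam : ∀ f ∈ subspaceVariety σ ℂ r d,
      ∃ (A : Matrix σ σ ℂ) (c : ↥(subMonomials σ S₀ d) → ℂ), f = linSubst σ ℂ A (evalForm S₀ d c) := by
    rintro f ⟨hf, g, S, hS, hvars⟩
    have hcard : S.card ≤ S₀.card := by
      rw [hS₀card]
      exact le_min hS (Finset.card_le_univ S)
    obtain ⟨g', hg'⟩ := exists_gl_vars_subset_of_card_le hcard ⟨g, hvars⟩
    have hhom : (linSubstRep σ ℂ g' f).IsHomogeneous d := by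
      rw [linSubstRep_apply]; exact linSubst_isHomogeneous _ hf
    refine ⟨((g'⁻¹ : GL σ ℂ) : Matrix σ σ ℂ), fun μ => coeff (μ : σ →₀ ℕ) (linSubstRep σ ℂ g' f), ?_⟩
    rw [← eq_evalForm_of_vars_subset hhom hg', ← linSubstRep_apply, ← Module.End.mul_apply,
      ← map_mul, inv_mul_cancel, map_one, Module.End.one_apply]
  -- parametrised points with invertible matrix lie in `Sub`
  have hmem : ∀ (A : Matrix σ σ ℂ) (c : ↥(subMonomials σ S₀ d) → ℂ), A.det ≠ 0 →
      linSubst σ ℂ A (evalForm S₀ d c) ∈ subspaceVariety σ ℂ r d := by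
    intro A c hA
    refine ⟨linSubst_isHomogeneous _ (evalForm_isHomogeneous c),
      (Matrix.GeneralLinearGroup.mkOfDetNeZero A hA)⁻¹, S₀, hS₀r, ?_⟩
    have h1 : linSubst σ ℂ A (evalForm S₀ d c) =
        linSubstRep σ ℂ (Matrix.GeneralLinearGroup.mkOfDetNeZero A hA) (evalForm S₀ d c) := by
      rw [linSubstRep_apply]; rfl
    rw [h1, ← Module.End.mul_apply, ← map_mul, inv_mul_cancel, map_one, Module.End.one_apply]
    exact vars_evalForm_subset c
  refine ⟨⟨0, isHomogeneous_zero _ _ _, 1, ∅, by simp, by simp⟩, fun C₁ C₂ hC₁ hC₂ hcover => ?_⟩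
  by_contra hnot
  obtain ⟨h1, h2⟩ := not_or.mp hnot
  obtain ⟨s₁, hs₁S, hs₁C⟩ := Set.not_subset.mp h1
  obtain ⟨s₂, hs₂S, hs₂C⟩ := Set.not_subset.mp h2
  obtain ⟨p₁, hp₁C, hp₁s⟩ := exists_aeval_ne_zero_of_not_mem hC₁ hs₁C
  obtain ⟨p₂, hp₂C, hp₂s⟩ := exists_aeval_ne_zero_of_not_mem hC₂ hs₂C
  set P₁ := aeval (fun ν : σ →₀ ℕ => coeff ν (paramTranslate S₀ d)) p₁ with hP₁
  set P₂ := aeval (fun ν : σ →₀ ℕ => coeff ν (paramTranslate S₀ d)) p₂ with hP₂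
  -- `P₁ · P₂ · det(A)` vanishes identically
  have hprod : P₁ * P₂ * (paramMatrix S₀ d).det = 0 := by
    apply MvPolynomial.funext
    intro x
    set A : Matrix σ σ ℂ := Matrix.of fun i j => x (Sum.inl (i, j)) with hAdef
    set c : ↥(subMonomials σ S₀ d) → ℂ := fun μ => x (Sum.inr μ) with hcdef
    have hx : x = Sum.elim (fun ij : σ × σ => A ij.1 ij.2) c := by
      funext y
      rcases y with ⟨i, j⟩ | μ
      · rfl
      · rfl
    rw [map_zero, hx, map_mul, map_mul, eval_det_paramMatrix, hP₁, hP₂, eval_pullback, eval_pullback]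
    by_cases hA : A.det = 0
    · rw [hA, mul_zero]
    rcases hcover (hmem A c hA) with hc | hc
    · rw [hp₁C _ hc, zero_mul, zero_mul]
    · rw [hp₂C _ hc, mul_zero, zero_mul]
  rcases mul_eq_zero.mp hprod with h12 | hdet
  · rcases mul_eq_zero.mp h12 with hP | hP
    · obtain ⟨A, c, hs⟩ := hparam s₁ hs₁S
      apply hp₁s
      rw [hs, ← eval_pullback, ← hP₁, hP, map_zero]
    · obtain ⟨A, c, hs⟩ := hparam s₂ hs₂S
      apply hp₂s
      rw [hs, ← eval_pullback, ← hP₂, hP, map_zero]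
  · exact det_paramMatrix_ne_zero S₀ d hdet

end Literature.Computability.AlgebraicComplexity
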